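import Summits.ValiantsHypothesis.ValiantsHypothesis.Theorems.LacunarySymmetroidMatrixDescartesPivotRankOneCriticalWindowsRootCount

/-!
# `MatrixDescartes` census — rank-one `(2,K)`: THE e-FREE EXPONENT PROFILE AND THE TWO-ROLLE COUNT
# (`Z₊(det F) ≤ 2 + #turning points of E`, ONE function `E` for every pivot exponent `e` and every pivot weight)

HONEST FRAMING.  Object-search cell `pub-symmetroid`, seat `val-sym-mdr-p1` (generation 26); helper file `--supports` the crux item
stmt-ValiantsHypothesis-18050 (`Theses.LacunarySymmetroid.MatrixDescartes`, OPEN, on HOLD) with NO closure claim.  A COUNTING INSTRUMENT for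
the rank-one hyperbolic `2 × 2` row `F(x) = x^e [[0,1],[1,0]] + ∑ₖ wₖ x^{dₖ} (1,tₖ)(1,tₖ)ᵀ` (`det F = A C − (U + x^e)²`, `A = ∑ Wₖ`, `U = ∑ Wₖtₖ`,
`C = ∑ Wₖtₖ²`, `Wₖ = wₖx^{dₖ}`); nothing here bears on `MatrixDescartes` in its window, on `DoorA26` / `DoorA34`, registers / credences,
or `VP ≠ VNP`; no register moves.

THE OBSERVATION (seat memo LEVEL-SET.md).  By `…RootCount.hasDerivAt_gapProfile` the gap profile `Φ_e(x) = (√(AC) − U)/x^e − 1` has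
`Φ_e′(x) = (∑ₖ (dₖ − e)Wₖ(T̂ − tₖ)²)/(2T̂x^{e+1})` with `A T̂² = C`.  Hence `Φ_e′(x) = 0 ⟺ E(x) = e` for the **EXPONENT PROFILE**
`E(x) := (∑ₖ dₖ·Wₖ(T̂ − tₖ)²)/(∑ₖ Wₖ(T̂ − tₖ)²)` — the mean exponent under the dent measure `πₖ ∝ Wₖ(T̂ − tₖ)²`, equivalently
`E = x·(log(√(AC) − U))′` — and `E` DOES NOT INVOLVE `e` (nor the pivot weight, which the normal form absorbs into the `wₖ`).  So the critical
scales of EVERY row `j | K−j` of the rank-one column (every position of `e` among the `dₖ`) are level sets of the SAME function, and two Rolle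
steps give, for every `e` at once, **`Z₊(det F) ≤ 2 + #{x > 0 : E′(x) = 0}`** (§3 `rankOne_card_posRoots_le_turning_add_two`).  No pivot
hypothesis (`dₚ < e < dₘ`) is needed: only positive weights and positions and two non-parallel letters.
* §1 `card_levelSet_le_card_add_one` — generic: a finite set of positive points where a function differentiable on `(0,∞)` takes one value has at
  most `#T + 1` elements if `T` contains the positive zeros of the derivative (Rolle, sorted `Finset`); budget form `card_levelSet_le_add_one`.
* §2 `dent_pos`, `differentiableAt_profile` — the denominator `∑ Wₖ(T̂ − tₖ)²` is positive and `E` is differentiable on `(0,∞)`;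
  `critical_iff_profile_eq` — `(x, T)` satisfies the two critical equations of `…CriticalWindowsLone*` (rates `dₘ − e`) for some `T > 0`
  iff `T = T̂(x)` solves the first and `E(x) = e`: THE LEVEL-SET DICTIONARY.
* §3 `card_critical_le_turning_add_one` (every finite set of critical scales of row `e` has `≤ #T + 1` elements, `T ⊇` positive zeros of
  `deriv E`), ★ `rankOne_card_posRoots_le_turning_add_two` and the budget form `rankOne_card_posRoots_le_add_two`.
LOCATED, NOT CLAIMED (seat numerics exp/infl*.py, levels.py; pure python): for `K = 3` letters `E` has at most 3 turning points (3 000 random +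
40 adversarial configurations; 3 is typical), which would give `≤ 4` critical directions for every `e` — in particular the non-parallel
two-letter per-side law of ROOT-COUNT.md §10 — and `Z₊ ≤ 5`; for `K = 4` up to 6 turning points occur (so «`≤ 2K − 3`» is false beyond
`K = 3`), while `max_e #{E = e} = 6 = 2K − 2` is the located maximum.

[folklore] Rolle's theorem (Mathlib `exists_hasDerivAt_eq_zero`), `Finset.orderEmbOfFin`, one-variable differentiability
(`DifferentiableAt.sqrt/.div/.sum`), tree `…RootCount.hasDerivAt_gapProfile` / `gapProfile_eq_zero_iff` / `moments_pos`,
`…PivotResolventRolle.card_posRoots_le_card_add_one`.  No definitions, no named facts.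
-/

-- `Summit.ValiantsHypothesis.ValiantsHypothesis.…` repeats a component by the D-0017 layout
-- (single-conjunct summit), which the `dupNamespace` linter flags; the name is mandated.
set_option linter.dupNamespace false

namespace Summit.ValiantsHypothesis.ValiantsHypothesis.Theorems.LacunarySymmetroidMatrixDescartes.Pivot.CriticalWindows.Turning

open Polynomial Finset Set
open scoped BigOperators
open Summit.ValiantsHypothesis.ValiantsHypothesis.Theorems.LacunarySymmetroidMatrixDescartes.Pivot.Resolvent
  (card_posRoots_le_card_add_one)
open Summit.ValiantsHypothesis.ValiantsHypothesis.Theorems.LacunarySymmetroidMatrixDescartes.Pivot.CriticalWindows.RootCount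
  (moments_pos gapProfile_eq_zero_iff hasDerivAt_gapProfile hasDerivAt_fewnomial)

/-! ## 1. A generic Rolle count for level sets on `(0,∞)` -/

/-- **ROLLE COUNT FOR A LEVEL SET.**  `ψ` has a derivative `ψ′` at every point of `(0,∞)`; `S` is a finite set of positive points at which
`ψ` takes the value `c`; `T` contains every positive zero of `ψ′`.  Then `#S ≤ #T + 1`. [folklore] -/
theorem card_levelSet_le_card_add_one (ψ ψ' : ℝ → ℝ) (c : ℝ) (hder : ∀ x, 0 < x → HasDerivAt ψ (ψ' x) x)
    (S : Finset ℝ) (hS : ∀ x ∈ S, 0 < x ∧ ψ x = c) (T : Finset ℝ) (hT : ∀ y, 0 < y → ψ' y = 0 → y ∈ T) :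
    S.card ≤ T.card + 1 := by
  classical
  obtain ⟨n, hn⟩ : ∃ n, S.card = n := ⟨_, rfl⟩
  rw [hn]
  set r := S.orderEmbOfFin hn with hr
  have hrS : ∀ j, r j ∈ S := fun j => Finset.orderEmbOfFin_mem _ _ _
  have hrpos : ∀ j, 0 < r j := fun j => (hS _ (hrS j)).1
  have hrval : ∀ j, ψ (r j) = c := fun j => (hS _ (hrS j)).2
  have hmono : ∀ i j : Fin n, (i : ℕ) < j → r i < r j := fun i j h => r.strictMono (Fin.lt_def.2 h)
  have hex : ∀ i : Fin (n - 1), ∃ y, r ⟨i, by omega⟩ < y ∧ y < r ⟨i + 1, by omega⟩ ∧ ψ' y = 0 := by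
    intro i
    have hlt : r ⟨i, by omega⟩ < r ⟨i + 1, by omega⟩ := hmono _ _ (by simp)
    have ha : 0 < r ⟨i, by omega⟩ := hrpos _
    have hcont : ContinuousOn ψ (Icc (r ⟨i, by omega⟩) (r ⟨i + 1, by omega⟩)) := by
      intro x hx
      exact (hder x (lt_of_lt_of_le ha hx.1)).continuousAt.continuousWithinAt
    have hends : ψ (r ⟨i, by omega⟩) = ψ (r ⟨i + 1, by omega⟩) := by rw [hrval, hrval]
    obtain ⟨y, hy, hy0⟩ := exists_hasDerivAt_eq_zero (f := ψ) (f' := ψ') hlt hcont hends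
      (fun x hx => hder x (ha.trans hx.1))
    exact ⟨y, hy.1, hy.2, hy0⟩
  choose y hy using hex
  have hyT : ∀ i : Fin (n - 1), y i ∈ T := fun i => hT (y i) ((hrpos _).trans (hy i).1) (hy i).2.2
  have hymono : StrictMono y := by
    intro i j hij
    have hij' : (i : ℕ) + 1 ≤ j := by
      have := Fin.lt_def.1 hij
      omega
    calc y i < r ⟨i + 1, by omega⟩ := (hy i).2.1
      _ ≤ r ⟨j, by omega⟩ := r.monotone (Fin.le_def.2 hij')
      _ < y j := (hy j).1
  have hcard : (Finset.univ : Finset (Fin (n - 1))).card ≤ T.card :=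
    Finset.card_le_card_of_injOn y (fun i _ => hyT i) hymono.injective.injOn
  rw [Finset.card_univ, Fintype.card_fin] at hcard
  omega

/-- **BUDGET FORM.**  If every finite set of positive zeros of `ψ′` has at most `N` elements, then every finite set of positive points where `ψ`
takes one value has at most `N + 1` elements (the budget makes the positive zero set of `ψ′` finite). [folklore] -/
theorem card_levelSet_le_add_one (ψ ψ' : ℝ → ℝ) (c : ℝ) (hder : ∀ x, 0 < x → HasDerivAt ψ (ψ' x) x) (N : ℕ)
    (hN : ∀ T : Finset ℝ, (∀ y ∈ T, 0 < y ∧ ψ' y = 0) → T.card ≤ N)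
    (S : Finset ℝ) (hS : ∀ x ∈ S, 0 < x ∧ ψ x = c) : S.card ≤ N + 1 := by
  classical
  set Z : Set ℝ := {y | 0 < y ∧ ψ' y = 0} with hZ
  have hfin : Z.Finite := by
    by_contra hinf
    obtain ⟨T, hTZ, hcard⟩ := Set.Infinite.exists_subset_card_eq hinf (N + 1)
    have := hN T fun y hy => hTZ hy
    omega
  have hcardT : hfin.toFinset.card ≤ N := hN _ fun y hy => by simpa [hZ] using hy
  have h := card_levelSet_le_card_add_one ψ ψ' c hder S hS hfin.toFinset
    (fun y hy h0 => by simpa [hZ] using And.intro hy h0)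
  omega

/-! ## 2. The exponent profile `E`: positivity of the dent sum, differentiability, the level-set dictionary -/

/-- The first critical equation at a positive direction `T` says `T = T̂(x) := √(C/A)`. [folklore] -/
theorem direction_eq_of_first {ι : Type*} (s : Finset ι) (hs : s.Nonempty) (w t : ι → ℝ) (d : ι → ℕ)
    (hw : ∀ m ∈ s, 0 < w m) (ht : ∀ m ∈ s, 0 < t m) {x T : ℝ} (hx : 0 < x) (hT : 0 < T)
    (h1 : ∑ m ∈ s, w m * x ^ d m * (T ^ 2 - t m ^ 2) = 0) :
    T = Real.sqrt ((∑ k ∈ s, w k * t k ^ 2 * x ^ d k) / (∑ k ∈ s, w k * x ^ d k)) := by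
  obtain ⟨hA, -, hC⟩ := moments_pos s hs w t d hw ht hx
  have hsum : ∑ m ∈ s, w m * x ^ d m * (T ^ 2 - t m ^ 2)
      = (∑ k ∈ s, w k * x ^ d k) * T ^ 2 - ∑ k ∈ s, w k * t k ^ 2 * x ^ d k := by
    rw [Finset.sum_mul, ← Finset.sum_sub_distrib]
    exact Finset.sum_congr rfl fun k _ => by ring
  rw [hsum, sub_eq_zero] at h1
  have hq : (∑ k ∈ s, w k * t k ^ 2 * x ^ d k) / (∑ k ∈ s, w k * x ^ d k) = T ^ 2 := by
    rw [div_eq_iff hA.ne', ← h1]; ring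
  rw [hq, Real.sqrt_sq hT.le]

/-- `T̂(x) = √(C/A)` is positive and solves the first critical equation `A T̂² = C`. [folklore] -/
theorem optDir_pos_sq {ι : Type*} (s : Finset ι) (hs : s.Nonempty) (w t : ι → ℝ) (d : ι → ℕ)
    (hw : ∀ m ∈ s, 0 < w m) (ht : ∀ m ∈ s, 0 < t m) {x : ℝ} (hx : 0 < x) :
    0 < Real.sqrt ((∑ k ∈ s, w k * t k ^ 2 * x ^ d k) / (∑ k ∈ s, w k * x ^ d k)) ∧
      (∑ k ∈ s, w k * x ^ d k) * Real.sqrt ((∑ k ∈ s, w k * t k ^ 2 * x ^ d k) / (∑ k ∈ s, w k * x ^ d k)) ^ 2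
        = ∑ k ∈ s, w k * t k ^ 2 * x ^ d k := by
  obtain ⟨hA, -, hC⟩ := moments_pos s hs w t d hw ht hx
  refine ⟨Real.sqrt_pos.2 (div_pos hC hA), ?_⟩
  rw [Real.sq_sqrt (div_pos hC hA).le]
  field_simp

/-- **THE DENT SUM IS POSITIVE.**  `∑ Wₖ(T − tₖ)² > 0` at every real `T` as soon as two letters have distinct positions (positive weights,
`x > 0`). [folklore] -/
theorem dent_pos {ι : Type*} (s : Finset ι) (w t : ι → ℝ) (d : ι → ℕ) (hw : ∀ m ∈ s, 0 < w m)
    {i j : ι} (hi : i ∈ s) (hj : j ∈ s) (hij : t i ≠ t j) {x : ℝ} (hx : 0 < x) (T : ℝ) :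
    0 < ∑ k ∈ s, w k * x ^ d k * (T - t k) ^ 2 := by
  have hnn : ∀ k ∈ s, 0 ≤ w k * x ^ d k * (T - t k) ^ 2 :=
    fun k hk => mul_nonneg (mul_pos (hw k hk) (pow_pos hx _)).le (sq_nonneg _)
  by_cases hTi : T = t i
  · refine Finset.sum_pos' hnn ⟨j, hj, mul_pos (mul_pos (hw j hj) (pow_pos hx _)) ?_⟩
    have : T - t j ≠ 0 := by rw [hTi]; exact sub_ne_zero.2 hij
    positivity
  · refine Finset.sum_pos' hnn ⟨i, hi, mul_pos (mul_pos (hw i hi) (pow_pos hx _)) ?_⟩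
    have : T - t i ≠ 0 := sub_ne_zero.2 hTi
    positivity

/-- **THE EXPONENT PROFILE IS DIFFERENTIABLE ON `(0,∞)`.**  `E(y) = (∑ dₖWₖ(T̂ − tₖ)²)/(∑ Wₖ(T̂ − tₖ)²)` with `T̂(y) = √(C(y)/A(y))`, for positive
weights and positions and two letters at distinct positions. [folklore] -/
theorem differentiableAt_profile {ι : Type*} (s : Finset ι) (w t : ι → ℝ) (d : ι → ℕ) (hw : ∀ m ∈ s, 0 < w m)
    (ht : ∀ m ∈ s, 0 < t m) {i j : ι} (hi : i ∈ s) (hj : j ∈ s) (hij : t i ≠ t j) {x : ℝ} (hx : 0 < x) :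
    DifferentiableAt ℝ (fun y =>
      (∑ k ∈ s, (d k : ℝ) * (w k * y ^ d k)
          * (Real.sqrt ((∑ l ∈ s, w l * t l ^ 2 * y ^ d l) / (∑ l ∈ s, w l * y ^ d l)) - t k) ^ 2)
        / (∑ k ∈ s, w k * y ^ d k
          * (Real.sqrt ((∑ l ∈ s, w l * t l ^ 2 * y ^ d l) / (∑ l ∈ s, w l * y ^ d l)) - t k) ^ 2)) x := by
  have hs : s.Nonempty := ⟨i, hi⟩
  obtain ⟨hA, -, hC⟩ := moments_pos s hs w t d hw ht hx
  have hdA : DifferentiableAt ℝ (fun y => ∑ l ∈ s, w l * y ^ d l) x := (hasDerivAt_fewnomial s w d x).differentiableAt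
  have hdC : DifferentiableAt ℝ (fun y => ∑ l ∈ s, w l * t l ^ 2 * y ^ d l) x :=
    (hasDerivAt_fewnomial s (fun l => w l * t l ^ 2) d x).differentiableAt
  have hτ : DifferentiableAt ℝ (fun y => Real.sqrt ((∑ l ∈ s, w l * t l ^ 2 * y ^ d l) / (∑ l ∈ s, w l * y ^ d l))) x :=
    (hdC.div hdA hA.ne').sqrt (div_pos hC hA).ne'
  have hterm : ∀ k ∈ s, DifferentiableAt ℝ (fun y => w k * y ^ d k
      * (Real.sqrt ((∑ l ∈ s, w l * t l ^ 2 * y ^ d l) / (∑ l ∈ s, w l * y ^ d l)) - t k) ^ 2) x :=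
    fun k _ => ((differentiableAt_pow (d k)).const_mul (w k)).mul ((hτ.sub_const (t k)).pow 2)
  have hterm' : ∀ k ∈ s, DifferentiableAt ℝ (fun y => (d k : ℝ) * (w k * y ^ d k)
      * (Real.sqrt ((∑ l ∈ s, w l * t l ^ 2 * y ^ d l) / (∑ l ∈ s, w l * y ^ d l)) - t k) ^ 2) x := by
    intro k hk
    have := (hterm k hk).const_mul (d k : ℝ)
    refine this.congr_of_eventuallyEq (Filter.Eventually.of_forall fun y => ?_)
    ring
  have hnum := DifferentiableAt.fun_sum (u := s) hterm'
  have hden := DifferentiableAt.fun_sum (u := s) hterm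
  refine hnum.div hden ?_
  exact (dent_pos s w t d hw hi hj hij hx _).ne'

/-- **THE LEVEL-SET DICTIONARY.**  For `x > 0` (positive weights and positions, two letters at distinct positions): there is a direction `T > 0`
with `(x, T)` satisfying BOTH critical equations of the window profile of row `e` — `∑ Wₘ(T² − tₘ²) = 0` and `∑ (dₘ − e)Wₘ(T − tₘ)² = 0`, the
currency of `…CriticalWindowsLone*` with rates `dₘ − e` — if and only if the e-FREE exponent profile takes the value `e` at `x`:
`E(x) = e`.  (`T` is then `T̂(x)`.) [folklore] -/
theorem critical_iff_profile_eq {ι : Type*} (s : Finset ι) (w t : ι → ℝ) (d : ι → ℕ) (e : ℕ) (hw : ∀ m ∈ s, 0 < w m)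
    (ht : ∀ m ∈ s, 0 < t m) {i j : ι} (hi : i ∈ s) (hj : j ∈ s) (hij : t i ≠ t j) {x : ℝ} (hx : 0 < x) :
    (∃ T, 0 < T ∧ (∑ m ∈ s, w m * x ^ d m * (T ^ 2 - t m ^ 2) = 0) ∧
        (∑ m ∈ s, ((d m : ℝ) - e) * (w m * x ^ d m) * (T - t m) ^ 2 = 0)) ↔
      (∑ k ∈ s, (d k : ℝ) * (w k * x ^ d k)
          * (Real.sqrt ((∑ l ∈ s, w l * t l ^ 2 * x ^ d l) / (∑ l ∈ s, w l * x ^ d l)) - t k) ^ 2)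
        / (∑ k ∈ s, w k * x ^ d k
          * (Real.sqrt ((∑ l ∈ s, w l * t l ^ 2 * x ^ d l) / (∑ l ∈ s, w l * x ^ d l)) - t k) ^ 2) = e := by
  have hs : s.Nonempty := ⟨i, hi⟩
  set τ := Real.sqrt ((∑ l ∈ s, w l * t l ^ 2 * x ^ d l) / (∑ l ∈ s, w l * x ^ d l)) with hτ
  obtain ⟨hτpos, hτC⟩ := optDir_pos_sq s hs w t d hw ht hx
  have hZ := dent_pos s w t d hw hi hj hij hx τ
  -- the second equation at a direction `T` is `N(T) − e·Z(T) = 0`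
  have hsplit : ∀ T : ℝ, ∑ m ∈ s, ((d m : ℝ) - e) * (w m * x ^ d m) * (T - t m) ^ 2
      = (∑ k ∈ s, (d k : ℝ) * (w k * x ^ d k) * (T - t k) ^ 2) - e * ∑ k ∈ s, w k * x ^ d k * (T - t k) ^ 2 := by
    intro T
    rw [Finset.mul_sum, ← Finset.sum_sub_distrib]
    exact Finset.sum_congr rfl fun k _ => by ring
  constructor
  · rintro ⟨T, hT, h1, h2⟩
    have hTτ : T = τ := direction_eq_of_first s hs w t d hw ht hx hT h1
    rw [hTτ, hsplit] at h2
    rw [div_eq_iff hZ.ne']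
    linarith
  · intro hE
    refine ⟨τ, hτpos, ?_, ?_⟩
    · have : ∑ m ∈ s, w m * x ^ d m * (τ ^ 2 - t m ^ 2)
          = (∑ k ∈ s, w k * x ^ d k) * τ ^ 2 - ∑ k ∈ s, w k * t k ^ 2 * x ^ d k := by
        rw [Finset.sum_mul, ← Finset.sum_sub_distrib]
        exact Finset.sum_congr rfl fun k _ => by ring
      rw [this, hτC, sub_self]
    · rw [hsplit]
      rw [div_eq_iff hZ.ne'] at hE
      linarith

/-! ## 3. Two Rolle steps: roots ≤ critical scales + 1 ≤ turning points + 2 -/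

/-- **CRITICAL SCALES ARE BOUNDED BY TURNING POINTS.**  Every finite set of positive scales carrying a critical point of the window profile of
row `e` (both critical equations, some direction `T > 0`) has at most `#T + 1` elements whenever the finite set `T` contains every positive
zero of the derivative of the e-free exponent profile `E`. [this file] -/
theorem card_critical_le_turning_add_one {ι : Type*} (s : Finset ι) (w t : ι → ℝ) (d : ι → ℕ) (e : ℕ) (hw : ∀ m ∈ s, 0 < w m)
    (ht : ∀ m ∈ s, 0 < t m) {i j : ι} (hi : i ∈ s) (hj : j ∈ s) (hij : t i ≠ t j)
    (S : Finset ℝ) (hS : ∀ x ∈ S, 0 < x ∧ ∃ T, 0 < T ∧ (∑ m ∈ s, w m * x ^ d m * (T ^ 2 - t m ^ 2) = 0) ∧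
        (∑ m ∈ s, ((d m : ℝ) - e) * (w m * x ^ d m) * (T - t m) ^ 2 = 0))
    (T : Finset ℝ) (hT : ∀ y, 0 < y → deriv (fun z =>
      (∑ k ∈ s, (d k : ℝ) * (w k * z ^ d k)
          * (Real.sqrt ((∑ l ∈ s, w l * t l ^ 2 * z ^ d l) / (∑ l ∈ s, w l * z ^ d l)) - t k) ^ 2)
        / (∑ k ∈ s, w k * z ^ d k
          * (Real.sqrt ((∑ l ∈ s, w l * t l ^ 2 * z ^ d l) / (∑ l ∈ s, w l * z ^ d l)) - t k) ^ 2)) y = 0 → y ∈ T) :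
    S.card ≤ T.card + 1 := by
  set E : ℝ → ℝ := fun z =>
      (∑ k ∈ s, (d k : ℝ) * (w k * z ^ d k)
          * (Real.sqrt ((∑ l ∈ s, w l * t l ^ 2 * z ^ d l) / (∑ l ∈ s, w l * z ^ d l)) - t k) ^ 2)
        / (∑ k ∈ s, w k * z ^ d k
          * (Real.sqrt ((∑ l ∈ s, w l * t l ^ 2 * z ^ d l) / (∑ l ∈ s, w l * z ^ d l)) - t k) ^ 2) with hEdef
  have hder : ∀ x, 0 < x → HasDerivAt E (deriv E x) x := fun x hx =>
    (differentiableAt_profile s w t d hw ht hi hj hij hx).hasDerivAt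
  refine card_levelSet_le_card_add_one E (deriv E) (e : ℝ) hder S (fun x hx => ?_) T hT
  obtain ⟨hx, hcrit⟩ := hS x hx
  exact ⟨hx, (critical_iff_profile_eq s w t d e hw ht hi hj hij hx).1 hcrit⟩

/-- **★ THE TWO-ROLLE COUNT (e-free).**  Rank-one hyperbolic pencil data on a `Finset`: positive weights `wₘ`, positive positions `tₘ` with
two letters at distinct positions, natural exponents `dₘ`, ANY natural pivot exponent `e`; `f` any real polynomial whose positive roots are the
positive zeros of `A C − (U + x^e)²` (`= det F`).  If the finite set `T` contains every positive zero of the derivative of the e-free exponent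
profile `E(x) = (∑ dₖWₖ(T̂ − tₖ)²)/(∑ Wₖ(T̂ − tₖ)²)`, `T̂ = √(C/A)`, then **`Z₊(f) ≤ #T + 2`**.  One function `E` for every row. [this file] -/
theorem rankOne_card_posRoots_le_turning_add_two {ι : Type*} (s : Finset ι) (w t : ι → ℝ) (d : ι → ℕ) (e : ℕ)
    (hw : ∀ m ∈ s, 0 < w m) (ht : ∀ m ∈ s, 0 < t m) {i j : ι} (hi : i ∈ s) (hj : j ∈ s) (hij : t i ≠ t j) (f : ℝ[X])
    (hf : ∀ x, 0 < x → (f.IsRoot x ↔ (∑ k ∈ s, w k * x ^ d k) * (∑ k ∈ s, w k * t k ^ 2 * x ^ d k)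
      - ((∑ k ∈ s, w k * t k * x ^ d k) + x ^ e) ^ 2 = 0))
    (T : Finset ℝ) (hT : ∀ y, 0 < y → deriv (fun z =>
      (∑ k ∈ s, (d k : ℝ) * (w k * z ^ d k)
          * (Real.sqrt ((∑ l ∈ s, w l * t l ^ 2 * z ^ d l) / (∑ l ∈ s, w l * z ^ d l)) - t k) ^ 2)
        / (∑ k ∈ s, w k * z ^ d k
          * (Real.sqrt ((∑ l ∈ s, w l * t l ^ 2 * z ^ d l) / (∑ l ∈ s, w l * z ^ d l)) - t k) ^ 2)) y = 0 → y ∈ T) :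
    (f.roots.toFinset.filter (fun r => 0 < r)).card ≤ T.card + 2 := by
  classical
  have hs : s.Nonempty := ⟨i, hi⟩
  -- the optimal direction and the gap profile of row `e`
  set τ : ℝ → ℝ := fun x => Real.sqrt ((∑ k ∈ s, w k * t k ^ 2 * x ^ d k) / (∑ k ∈ s, w k * x ^ d k)) with hτdef
  have hτ : ∀ x, 0 < x → 0 < τ x ∧ (∑ k ∈ s, w k * x ^ d k) * τ x ^ 2 = ∑ k ∈ s, w k * t k ^ 2 * x ^ d k :=
    fun x hx => optDir_pos_sq s hs w t d hw ht hx
  set φ : ℝ → ℝ := fun y => (Real.sqrt ((∑ k ∈ s, w k * y ^ d k) * (∑ k ∈ s, w k * t k ^ 2 * y ^ d k))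
      - ∑ k ∈ s, w k * t k * y ^ d k) / y ^ e - 1 with hφdef
  set φ' : ℝ → ℝ := fun x => (∑ k ∈ s, ((d k : ℝ) - e) * (w k * x ^ d k) * (τ x - t k) ^ 2) / (2 * τ x * x ^ (e + 1))
    with hφ'def
  have hφ : ∀ x, 0 < x → (φ x = 0 ↔ f.IsRoot x) := by
    intro x hx
    obtain ⟨hA, hU, hC⟩ := moments_pos s hs w t d hw ht hx
    rw [hf x hx, hφdef]
    exact gapProfile_eq_zero_iff _ _ _ _ (mul_pos hA hC).le (add_pos hU (pow_pos hx e)).le (pow_pos hx e)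
  have hder : ∀ x, 0 < x → HasDerivAt φ (φ' x) x := fun x hx =>
    hasDerivAt_gapProfile s hs w t d e hw ht hx (hτ x hx).1 (hτ x hx).2
  -- a critical point of the gap profile carries a critical point of the window profile with direction T̂
  have hE1 : ∀ x, 0 < x → ∑ m ∈ s, w m * x ^ d m * (τ x ^ 2 - t m ^ 2) = 0 := by
    intro x hx
    have : ∑ m ∈ s, w m * x ^ d m * (τ x ^ 2 - t m ^ 2)
        = (∑ k ∈ s, w k * x ^ d k) * τ x ^ 2 - ∑ k ∈ s, w k * t k ^ 2 * x ^ d k := by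
      rw [Finset.sum_mul, ← Finset.sum_sub_distrib]
      exact Finset.sum_congr rfl fun k _ => by ring
    rw [this, (hτ x hx).2, sub_self]
  have hE2 : ∀ c, 0 < c → φ' c = 0 → ∑ m ∈ s, ((d m : ℝ) - e) * (w m * c ^ d m) * (τ c - t m) ^ 2 = 0 := by
    intro c hc h0
    rw [hφ'def, div_eq_zero_iff] at h0
    rcases h0 with h0 | h0
    · exact h0
    · exact absurd h0 (mul_pos (mul_pos two_pos (hτ c hc).1) (pow_pos hc _)).ne'
  -- the set of positive critical points of the gap profile is finite with at most #T + 1 elements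
  set crit : Set ℝ := {c | 0 < c ∧ φ' c = 0} with hcrit
  have hbudget : ∀ S : Finset ℝ, (∀ c ∈ S, 0 < c ∧ φ' c = 0) → S.card ≤ T.card + 1 := by
    intro S hS
    refine card_critical_le_turning_add_one s w t d e hw ht hi hj hij S (fun x hx => ?_) T hT
    obtain ⟨hx, h0⟩ := hS x hx
    exact ⟨hx, τ x, (hτ x hx).1, hE1 x hx, hE2 x hx h0⟩
  have hfin : crit.Finite := by
    by_contra hinf
    obtain ⟨S, hS, hcard⟩ := Set.Infinite.exists_subset_card_eq hinf (T.card + 2)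
    have := hbudget S fun c hc => hS hc
    omega
  have hcardcrit : hfin.toFinset.card ≤ T.card + 1 := hbudget _ fun c hc => by simpa [hcrit] using hc
  have h := card_posRoots_le_card_add_one f φ φ' hφ hder hfin.toFinset
    (fun c hc h0 => by simpa [hcrit] using And.intro hc h0)
  omega

/-- **BUDGET FORM OF THE TWO-ROLLE COUNT.**  Same data; if every finite set of positive zeros of the derivative of the e-free exponent profile
has at most `N` elements, then `Z₊(f) ≤ N + 2` — for every pivot exponent `e`. [this file] -/
theorem rankOne_card_posRoots_le_add_two {ι : Type*} (s : Finset ι) (w t : ι → ℝ) (d : ι → ℕ) (e : ℕ)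
    (hw : ∀ m ∈ s, 0 < w m) (ht : ∀ m ∈ s, 0 < t m) {i j : ι} (hi : i ∈ s) (hj : j ∈ s) (hij : t i ≠ t j) (f : ℝ[X])
    (hf : ∀ x, 0 < x → (f.IsRoot x ↔ (∑ k ∈ s, w k * x ^ d k) * (∑ k ∈ s, w k * t k ^ 2 * x ^ d k)
      - ((∑ k ∈ s, w k * t k * x ^ d k) + x ^ e) ^ 2 = 0))
    (N : ℕ) (hN : ∀ T : Finset ℝ, (∀ y ∈ T, 0 < y ∧ deriv (fun z =>
      (∑ k ∈ s, (d k : ℝ) * (w k * z ^ d k)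
          * (Real.sqrt ((∑ l ∈ s, w l * t l ^ 2 * z ^ d l) / (∑ l ∈ s, w l * z ^ d l)) - t k) ^ 2)
        / (∑ k ∈ s, w k * z ^ d k
          * (Real.sqrt ((∑ l ∈ s, w l * t l ^ 2 * z ^ d l) / (∑ l ∈ s, w l * z ^ d l)) - t k) ^ 2)) y = 0) → T.card ≤ N) :
    (f.roots.toFinset.filter (fun r => 0 < r)).card ≤ N + 2 := by
  classical
  set E : ℝ → ℝ := fun z =>
      (∑ k ∈ s, (d k : ℝ) * (w k * z ^ d k)
          * (Real.sqrt ((∑ l ∈ s, w l * t l ^ 2 * z ^ d l) / (∑ l ∈ s, w l * z ^ d l)) - t k) ^ 2)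
        / (∑ k ∈ s, w k * z ^ d k
          * (Real.sqrt ((∑ l ∈ s, w l * t l ^ 2 * z ^ d l) / (∑ l ∈ s, w l * z ^ d l)) - t k) ^ 2) with hEdef
  set Z : Set ℝ := {y | 0 < y ∧ deriv E y = 0} with hZ
  have hfin : Z.Finite := by
    by_contra hinf
    obtain ⟨T, hTZ, hcard⟩ := Set.Infinite.exists_subset_card_eq hinf (N + 1)
    have := hN T fun y hy => hTZ hy
    omega
  have hcardT : hfin.toFinset.card ≤ N := hN _ fun y hy => by simpa [hZ] using hy
  have h := rankOne_card_posRoots_le_turning_add_two s w t d e hw ht hi hj hij f hf hfin.toFinset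
    (fun y hy h0 => by simpa [hZ] using And.intro hy h0)
  omega

end Summit.ValiantsHypothesis.ValiantsHypothesis.Theorems.LacunarySymmetroidMatrixDescartes.Pivot.CriticalWindows.Turning
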